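import Literature.NumberTheory.Automorphic.ZariskiGL
import Literature.NumberTheory.Automorphic.ZariskiAffineSpace
import HarnessLib

/-!
# `GL n k` in affine space: products, irreducibility, Springer 2.2.1 and 2.2.4 (ii)
(trunk T-AUTOMORPHIC, G25 AutomorphicL)

Companion to `ZariskiGL.lean` (the Zariski topology `zariskiTopologyGL` on `GL n k`, a local
instance; Springer 2.2.1 (i) `IsZConnected.isIrreducible`, the closure `zariskiClosure` of a
subgroup) and `ZariskiAffineSpace.lean` (the Zariski topology `zariskiTopologyPi` on `σ → k`,
products `prodSet`, Chevalley's theorem on images), in the same `k`-points vocabulary. Proved here: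

* `zariskiTopologyGL_eq_induced`: the topology of `ZariskiGL.lean` *is* the topology induced from
  affine space `k^{n × n + 1}` along the coordinates `glCoordFun = (x i j, det⁻¹)`; hence
  `glCoordFun` is a closed embedding with image the hypersurface `det (x) · y = 1`
  (`isClosedEmbedding_glCoordFun`, `range_glCoordFun`; Springer 2.1.4), and maps `GL n k → kᵐ`
  with polynomial coordinates are continuous;
* `image_mulPolyGL_prodSet`: multiplication read in coordinates carries `X × Y ⊆ k^{ρ ⊕ ρ}`
  (`prodSet`) onto the coordinates of `X · Y`;
* translates, inverses and closures: `zariskiInv`, `smul_closure_GL`, `closure_mul_singleton`,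
  `inv_closure_GL`, `closure_mul_closure_subset` (`X̄ · Ȳ ⊆ cl (X Y)`, Springer 2.2.4 (i));
* **`isIrreducible_mul`**: `X · Y` is irreducible for irreducible `X, Y ⊆ GL n k` (Springer 1.2.3
  with 1.5.4 (ii); proved by the slice argument, over any field), `isIrreducible_inv`,
  `isIrreducible_image_glCoordFun`;
* **`isClosed_of_isOpen_inter_closure`** — Springer 2.2.4 (ii): a subgroup containing a non-empty
  relatively open subset of its closure is closed (via 2.2.3);
* **`isZConnected_of_isIrreducible`**, `isZConnected_iff_isIrreducible` — the converse half of
  Springer 2.2.1: closed irreducible subgroups are connected in the sense of `IsZConnected` (a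
  closed finite-index subgroup is one of finitely many disjoint closed cosets); `isZConnected_bot`.

With Chevalley's theorem these are the inputs of Springer 2.2.6–2.2.7 (i) (the subgroup generated
by closed connected subgroups is closed and connected).

## Library

Sibling vocabularies on naive points elsewhere in the tree, not imported here to keep the import
closure small: `Literature.IsZariskiClosed K S` and `Literature.NumberTheory.Transcendental.zariskiDim` in
`Literature/NumberTheory/Transcendental/ExpVarieties.lean` (for `S : Set (ι → K)` the former is
literally the right-hand side of `isClosed_iff_exists_zeroLocus` of `ZariskiAffineSpace.lean`;
for the latter cf. `IsZConnected.zdim` of `ZariskiGLDimension.lean`), and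
`Literature.CplxAlg.zariskiClosure S = Z(I(S))` in
`Literature/Computability/AlgebraicComplexity/OrbitClosure.lean` (the topological closure for
`zariskiTopologyPi`). The bridges are one-liners for a file importing both sides.

## References

* T. A. Springer, *Linear Algebraic Groups*, 2nd ed., Progress in Mathematics 9, Birkhäuser
  (1998), 1.2.3, 1.5.4 (ii), 2.1.4, 2.2.1, 2.2.3, 2.2.4.
-/

noncomputable section

open scoped MatrixGroups Pointwise
open Topology

namespace Literature.NumberTheory.Automorphic

variable {k : Type*} [Field k] {n : Type*} [Fintype n] [DecidableEq n] {σ τ : Type*}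

attribute [local instance] zariskiTopologyPi zariskiTopologyGL


/-! ### `GL n k` as a closed subvariety of affine space -/

section GLTopology

/-- The Zariski topology of `GL n k` (`ZariskiGL.lean`: closed sets = `zeroLocusGL S`) is the
topology induced from affine space `k^{n × n + 1}` along the coordinates `x i j, det⁻¹`
(Springer 2.1.4). [folklore] -/
theorem zariskiTopologyGL_eq_induced :
    zariskiTopologyGL n k =
      TopologicalSpace.induced glCoordFun (zariskiTopologyPi (GLCoord n) k) := by
  refine TopologicalSpace.ext_isClosed fun Z => ?_
  rw [isClosed_zariski_iff, isClosed_induced_iff]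
  constructor
  · rintro ⟨S, rfl⟩
    refine ⟨{x | ∀ p ∈ S, MvPolynomial.eval x p = 0}, isClosed_setOf_forall_eval_eq_zero S, ?_⟩
    ext g
    simp [zeroLocusGL]
  · rintro ⟨C, hC, rfl⟩
    obtain ⟨S, rfl⟩ := isClosed_iff_exists_setOf_eval.1 hC
    exact ⟨S, by ext g; simp [zeroLocusGL]⟩

/-- The coordinate map `glCoordFun : GL n k → k^{n × n + 1}` induces the Zariski topology of
`GL n k`. [folklore] -/
theorem isInducing_glCoordFun : IsInducing (glCoordFun : GL n k → GLCoord n → k) :=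
  ⟨zariskiTopologyGL_eq_induced⟩

/-- The coordinate map is Zariski continuous. [folklore] -/
theorem continuous_glCoordFun : Continuous (glCoordFun : GL n k → GLCoord n → k) :=
  isInducing_glCoordFun.continuous

/-- A map `GL n k → kᵐ` with polynomial coordinates is Zariski continuous. [folklore] -/
theorem continuous_of_polynomial_GL_pi {φ : GL n k → (τ → k)}
    (P : τ → MvPolynomial (GLCoord n) k)
    (hφ : ∀ g t, φ g t = MvPolynomial.eval (glCoordFun g) (P t)) : Continuous φ := by
  have : φ = (fun (x : GLCoord n → k) (t : τ) => MvPolynomial.eval x (P t)) ∘ glCoordFun :=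
    funext fun g => funext fun t => hφ g t
  rw [this]
  exact (continuous_of_polynomialMap P fun _ _ => rfl).comp continuous_glCoordFun

/-- Evaluating the generic matrix at a point `v` of affine space gives the matrix of the entry
coordinates of `v`. [folklore] -/
lemma eval_mapMatrix_genericMatrixGL_pi (v : GLCoord n → k) :
    (MvPolynomial.eval v).mapMatrix (genericMatrixGL n k) =
      Matrix.of fun i j => v (Sum.inl (i, j)) := by
  ext i j; simp [genericMatrixGL]

/-- The image of `GL n k` in affine space `k^{n × n + 1}` is the hypersurface `det (x) · y = 1`
(Springer 2.1.4). [folklore] -/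
theorem range_glCoordFun :
    Set.range (glCoordFun : GL n k → GLCoord n → k) =
      {v | MvPolynomial.eval v ((genericMatrixGL n k).det * MvPolynomial.X (Sum.inr ())) = 1} := by
  ext v
  simp only [Set.mem_range, Set.mem_setOf_eq, map_mul, MvPolynomial.eval_X, RingHom.map_det,
    eval_mapMatrix_genericMatrixGL_pi]
  constructor
  · rintro ⟨g, rfl⟩
    have : (Matrix.of fun i j => glCoordFun g (Sum.inl (i, j))) = (g : Matrix n n k) := by
      ext i j; rfl
    rw [this, glCoordFun_inr]
    exact mul_inv_cancel₀ (Matrix.isUnits_det_units g).ne_zero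
  · intro hv
    have hdet : (Matrix.of fun i j => v (Sum.inl (i, j))).det ≠ 0 := left_ne_zero_of_mul_eq_one hv
    have hu : IsUnit (Matrix.of fun i j => v (Sum.inl (i, j))) :=
      (Matrix.isUnit_iff_isUnit_det _).2 (isUnit_iff_ne_zero.2 hdet)
    refine ⟨hu.unit, funext fun c => ?_⟩
    rcases c with ⟨i, j⟩ | u
    · rw [glCoordFun_inl, hu.unit_spec, Matrix.of_apply]
    · rw [glCoordFun_inr, hu.unit_spec]
      exact (eq_inv_of_mul_eq_one_right hv).symm

/-- The image of `GL n k` in affine space is closed. [folklore] -/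
theorem isClosed_range_glCoordFun : IsClosed (Set.range (glCoordFun : GL n k → GLCoord n → k)) := by
  rw [range_glCoordFun]
  convert isClosed_setOf_eval_eq_zero
    ((genericMatrixGL n k).det * MvPolynomial.X (Sum.inr ()) - 1) using 1
  ext v
  simp only [Set.mem_setOf_eq, map_sub, map_one, sub_eq_zero]

/-- `glCoordFun` is a closed embedding of `GL n k` into affine space `k^{n × n + 1}`
(Springer 2.1.4: `GL n` is the closed subvariety `det (x) · y = 1`). [folklore] -/
theorem isClosedEmbedding_glCoordFun :
    IsClosedEmbedding (glCoordFun : GL n k → GLCoord n → k) :=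
  ⟨⟨isInducing_glCoordFun, glCoordFun_injective⟩, isClosed_range_glCoordFun⟩

/-- Multiplication of `GL n` read in coordinates: the polynomial map `mulPolyGL` on
`k^{(n × n + 1) ⊕ (n × n + 1)}` carries `X × Y` onto (the coordinates of) `X · Y`. [folklore] -/
theorem image_mulPolyGL_prodSet (X Y : Set (GL n k)) :
    (fun (v : GLCoord n ⊕ GLCoord n → k) (c : GLCoord n) => MvPolynomial.eval v (mulPolyGL c)) ''
        prodSet (glCoordFun '' X) (glCoordFun '' Y) = glCoordFun '' (X * Y) := by
  ext w
  simp only [Set.mem_image, mem_prodSet]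
  constructor
  · rintro ⟨v, ⟨⟨g, hg, hgv⟩, ⟨h, hh, hhv⟩⟩, rfl⟩
    refine ⟨g * h, Set.mul_mem_mul hg hh, funext fun c => ?_⟩
    rw [← eval_mulPolyGL, hgv, hhv, sumElim_inl_inr]
  · rintro ⟨_, ⟨g, hg, h, hh, rfl⟩, rfl⟩
    refine ⟨Sum.elim (glCoordFun g) (glCoordFun h), ⟨⟨g, hg, rfl⟩, ⟨h, hh, rfl⟩⟩,
      funext fun c => ?_⟩
    exact eval_mulPolyGL g h c

/-- Inversion, as a homeomorphism of `GL n k` for the Zariski topology (Springer 2.1.2, 2.1.4: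
`g⁻¹ = det⁻¹ · adj g`). [folklore] -/
def zariskiInv : GL n k ≃ₜ GL n k where
  toEquiv := Equiv.inv (GL n k)
  continuous_toFun := continuous_inv_zariski
  continuous_invFun := continuous_inv_zariski

/-- `zariskiInv` is `g ↦ g⁻¹`. [folklore] -/
@[simp] lemma zariskiInv_apply (g : GL n k) : zariskiInv g = g⁻¹ := rfl

/-- The image of a set under left translation is its left translate. [folklore] -/
lemma image_zariskiMulLeft (h : GL n k) (X : Set (GL n k)) : zariskiMulLeft h '' X = h • X := by
  ext g
  rw [Set.mem_smul_set]
  exact Iff.rfl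

/-- The image of a set under right translation is its right translate. [folklore] -/
lemma image_zariskiMulRight (h : GL n k) (X : Set (GL n k)) :
    zariskiMulRight h '' X = X * {h} := by
  rw [Set.mul_singleton]; rfl

/-- The image of a set under inversion is its pointwise inverse. [folklore] -/
lemma image_zariskiInv (X : Set (GL n k)) : zariskiInv '' X = X⁻¹ := by
  rw [← Set.image_inv_eq_inv]; rfl

/-- Left translates of closures: `h · closure X = closure (h · X)`. [folklore] -/
theorem smul_closure_GL (h : GL n k) (X : Set (GL n k)) : h • closure X = closure (h • X) := by
  have := (zariskiMulLeft h).image_closure X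
  rwa [image_zariskiMulLeft, image_zariskiMulLeft] at this

/-- Right translates of closures: `closure X · h = closure (X · h)`. [folklore] -/
theorem closure_mul_singleton (X : Set (GL n k)) (h : GL n k) :
    closure X * {h} = closure (X * {h}) := by
  have := (zariskiMulRight h).image_closure X
  rwa [image_zariskiMulRight, image_zariskiMulRight] at this

/-- Inverses of closures: `(closure X)⁻¹ = closure X⁻¹`. [folklore] -/
theorem inv_closure_GL (X : Set (GL n k)) : (closure X)⁻¹ = closure X⁻¹ := by
  have := (zariskiInv (n := n) (k := k)).image_closure X
  rwa [image_zariskiInv, image_zariskiInv] at this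

/-- `closure X · closure Y ⊆ closure (X · Y)` (the argument of Springer 2.2.4 (i)). [folklore] -/
theorem closure_mul_closure_subset (X Y : Set (GL n k)) :
    closure X * closure Y ⊆ closure (X * Y) := by
  -- first `closure X · y ⊆ closure (X Y)` for `y ∈ Y`, then `x' · closure Y ⊆ closure (X Y)`
  have h1 : closure X * Y ⊆ closure (X * Y) := by
    rintro _ ⟨x', hx', y, hy, rfl⟩
    have : closure X * {y} ⊆ closure (X * Y) := by
      rw [closure_mul_singleton]
      exact closure_mono (Set.mul_subset_mul_left (Set.singleton_subset_iff.2 hy))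
    exact this (Set.mul_mem_mul hx' rfl)
  rintro _ ⟨x', hx', y', hy', rfl⟩
  have h2 : x' • closure Y ⊆ closure (X * Y) := by
    rw [smul_closure_GL]
    refine closure_minimal ?_ isClosed_closure
    rintro _ ⟨y, hy, rfl⟩
    exact h1 (Set.mul_mem_mul hx' hy)
  exact h2 (Set.smul_mem_smul_set hy')

/-! ### Irreducible subsets of `GL n k` -/

/-- **Products of irreducible subsets of `GL n k` are irreducible**: if `X, Y ⊆ GL n k` are
irreducible then so is `X · Y` (Springer 1.2.3, 1.5.4 (ii) with 2.2.1: `XY` is the image of the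
irreducible `X × Y` under multiplication). The proof avoids product varieties: for `x ∈ X` the
translate `x Y` is irreducible, and `{x | x Y ⊆ Z}` is closed for `Z` closed; this works over any
field. [folklore] -/
theorem isIrreducible_mul {X Y : Set (GL n k)} (hX : IsIrreducible X) (hY : IsIrreducible Y) :
    IsIrreducible (X * Y) := by
  refine ⟨hX.nonempty.mul hY.nonempty, ?_⟩
  rw [isPreirreducible_iff_isClosed_union_isClosed]
  intro Z₁ Z₂ hZ₁ hZ₂ hXY
  -- the closed sets `C Z = {x | x Y ⊆ Z}`
  let C : Set (GL n k) → Set (GL n k) := fun Z => ⋂ y ∈ Y, zariskiMulRight y ⁻¹' Z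
  have hC : ∀ Z, IsClosed Z → IsClosed (C Z) := fun Z hZ =>
    isClosed_biInter fun y _ => hZ.preimage (zariskiMulRight y).continuous
  have hmemC : ∀ {Z x}, x ∈ C Z ↔ ∀ y ∈ Y, x * y ∈ Z := fun {Z x} => by
    simp only [C, Set.mem_iInter, Set.mem_preimage, zariskiMulRight_apply]
  -- each `x ∈ X` lies in `C Z₁ ∪ C Z₂`, by irreducibility of `x • Y`
  have hXC : X ⊆ C Z₁ ∪ C Z₂ := by
    intro x hx
    have hirr : IsIrreducible (x • Y) := IsIrreducible.smul_zariski hY x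
    have hsub : x • Y ⊆ Z₁ ∪ Z₂ := by
      rintro _ ⟨y, hy, rfl⟩
      exact hXY (Set.mul_mem_mul hx hy)
    rcases (isPreirreducible_iff_isClosed_union_isClosed.1 hirr.2) Z₁ Z₂ hZ₁ hZ₂ hsub with h | h
    · exact Or.inl (hmemC.2 fun y hy => h (Set.smul_mem_smul_set hy))
    · exact Or.inr (hmemC.2 fun y hy => h (Set.smul_mem_smul_set hy))
  rcases (isPreirreducible_iff_isClosed_union_isClosed.1 hX.2) _ _ (hC Z₁ hZ₁) (hC Z₂ hZ₂) hXC
    with h | h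
  · left
    rintro _ ⟨x, hx, y, hy, rfl⟩
    exact hmemC.1 (h hx) y hy
  · right
    rintro _ ⟨x, hx, y, hy, rfl⟩
    exact hmemC.1 (h hx) y hy

/-- Inverses of irreducible sets are irreducible. [folklore] -/
theorem isIrreducible_inv {X : Set (GL n k)} (hX : IsIrreducible X) : IsIrreducible X⁻¹ := by
  rw [← image_zariskiInv]
  exact hX.image _ zariskiInv.continuous.continuousOn

/-- Images in affine space of irreducible subsets of `GL n k` are irreducible. [folklore] -/
theorem isIrreducible_image_glCoordFun {X : Set (GL n k)} (hX : IsIrreducible X) :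
    IsIrreducible (glCoordFun '' X) :=
  hX.image _ continuous_glCoordFun.continuousOn

end GLTopology

/-! ### Springer 2.2.4 (ii) and the converse half of 2.2.1 -/

section Closure

/-- **Springer 2.2.4 (ii)**: a subgroup `H ≤ GL n k` containing a non-empty relatively open
subset `V ∩ closure H` of its closure is closed. (`H` is then open in the group `closure H`
(2.2.4 (i), `zariskiClosure`), and the open `⋃ h V` meets every coset `z H`, `z ∈ closure H`,
since `z H` is dense in `closure H`: the argument of 2.2.3.)
[cite: SpringerLAG1998, Lemma 2.2.4 (ii)] -/
theorem isClosed_of_isOpen_inter_closure (H : Subgroup (GL n k)) {V : Set (GL n k)}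
    (hV : IsOpen V) (hne : (V ∩ closure (H : Set (GL n k))).Nonempty)
    (hVH : V ∩ closure (H : Set (GL n k)) ⊆ H) : IsClosed (H : Set (GL n k)) := by
  set Z : Subgroup (GL n k) := zariskiClosure H with hZdef
  have hZ : (Z : Set (GL n k)) = closure H := rfl
  obtain ⟨o, hoV, hoZ⟩ := hne
  have hoH : o ∈ H := hVH ⟨hoV, hoZ⟩
  -- `V' = ⋃_{h ∈ H} h V` is open and `H = V' ∩ Z`
  set V' : Set (GL n k) := ⋃ h ∈ H, h • V with hV'def
  have hV' : IsOpen V' := isOpen_biUnion fun h _ => by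
    rw [← image_zariskiMulLeft]; exact (zariskiMulLeft h).isOpenMap V hV
  have hHV'Z : (H : Set (GL n k)) = V' ∩ Z := by
    refine Set.Subset.antisymm (fun x hx => ⟨?_, subset_closure hx⟩) ?_
    · refine Set.mem_biUnion (H.mul_mem hx (H.inv_mem hoH)) ⟨o, hoV, ?_⟩
      simp
    · rintro x ⟨hxV', hxZ⟩
      obtain ⟨h, hh, hxh⟩ := Set.mem_iUnion₂.1 hxV'
      obtain ⟨v, hv, rfl⟩ := hxh
      have hvZ : v ∈ closure (H : Set (GL n k)) := by
        have : h⁻¹ * (h • v) ∈ Z := Z.mul_mem (Z.inv_mem (le_zariskiClosure H hh)) hxZ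
        rw [smul_eq_mul, inv_mul_cancel_left] at this
        exact this
      have hvH : v ∈ H := hVH ⟨hv, hvZ⟩
      exact H.mul_mem hh hvH
  -- `Z ⊆ H`: for `z ∈ Z`, the open `V'` meets `z H` (whose closure is `Z ∋ o`)
  suffices hZH : (Z : Set (GL n k)) ⊆ H by
    rw [← Set.Subset.antisymm hZH (le_zariskiClosure H)]
    exact isClosed_closure
  intro z hz
  have hoV' : o ∈ V' := Set.mem_biUnion H.one_mem (by simpa using hoV)
  have hclo : closure (z • (H : Set (GL n k))) = Z := by
    rw [← smul_closure_GL, ← hZ, smul_coe_set hz]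
  have ho : o ∈ closure (z • (H : Set (GL n k))) := by rw [hclo]; exact hoZ
  obtain ⟨y, hyV', hyzH⟩ := mem_closure_iff.1 ho V' hV' hoV'
  obtain ⟨h, hh, rfl⟩ := hyzH
  have hzhZ : z • h ∈ (Z : Set (GL n k)) := Z.mul_mem hz (le_zariskiClosure H hh)
  have hzhH : z • h ∈ H := by
    have : z • h ∈ V' ∩ (Z : Set (GL n k)) := ⟨hyV', hzhZ⟩
    rwa [← hHV'Z] at this
  simpa using H.mul_mem hzhH (H.inv_mem hh)

/-- The left cosets in `H` of a subgroup `K` of finite index form a finite family of subsets.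
[folklore] -/
lemma finite_leftCosets_of_finiteIndex {H K : Subgroup (GL n k)}
    (hfi : (K.subgroupOf H).FiniteIndex) :
    (Set.range fun x : ↥H => (x : GL n k) • (K : Set (GL n k))).Finite := by
  haveI := hfi
  let K' := K.subgroupOf H
  haveI : Finite (↥H ⧸ K') := Subgroup.finite_quotient_of_finiteIndex
  -- the coset map factors through the finite quotient `H ⧸ K'`
  let f : ↥H ⧸ K' → Set (GL n k) := Quotient.lift (fun x : ↥H => (x : GL n k) • (K : Set (GL n k)))
    (by
      intro x y hxy
      have hxy' := Subgroup.mem_subgroupOf.1 (QuotientGroup.leftRel_apply.1 hxy)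
      change (x : GL n k) • (K : Set (GL n k)) = (y : GL n k) • (K : Set (GL n k))
      rw [leftCoset_eq_iff]
      simpa using hxy')
  have : (Set.range fun x : ↥H => (x : GL n k) • (K : Set (GL n k))) ⊆ Set.range f := by
    rintro _ ⟨x, rfl⟩
    exact ⟨(x : ↥H ⧸ K'), rfl⟩
  exact (Set.finite_range f).subset this

/-- **Springer 2.2.1, converse half**: a closed irreducible subgroup of `GL n k` is
Zariski-connected — a closed subgroup of finite index is one of finitely many pairwise disjoint
closed cosets covering the irreducible group (2.2.1 (iii)). Holds over any field.
[cite: SpringerLAG1998, Prop 2.2.1] -/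
theorem isZConnected_of_isIrreducible {H : Subgroup (GL n k)} (hH : IsAlgebraicSubgroup H)
    (hirr : IsIrreducible (H : Set (GL n k))) : IsZConnected H := by
  refine ⟨hH, fun K hKH hK hfi => ?_⟩
  have hfin := finite_leftCosets_of_finiteIndex hfi
  -- `H` is covered by the finitely many closed cosets `x K`, `x ∈ H`
  have hcov : (H : Set (GL n k)) ⊆ ⋃₀ ↑hfin.toFinset := by
    intro x hx
    refine Set.mem_sUnion.2 ⟨x • (K : Set (GL n k)), ?_, ?_⟩
    · rw [Set.Finite.coe_toFinset]; exact ⟨⟨x, hx⟩, rfl⟩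
    · simpa using Set.smul_mem_smul_set (a := x) K.one_mem
  have hclosed : ∀ C ∈ hfin.toFinset, IsClosed C := by
    intro C hC
    rw [Set.Finite.mem_toFinset] at hC
    obtain ⟨x, rfl⟩ := hC
    change IsClosed ((x : GL n k) • (K : Set (GL n k)))
    rw [← image_zariskiMulLeft]
    exact (zariskiMulLeft (x : GL n k)).isClosedMap _ hK.isClosed
  obtain ⟨C, hC, hHC⟩ := isIrreducible_iff_sUnion_isClosed.1 hirr hfin.toFinset hclosed hcov
  rw [Set.Finite.mem_toFinset] at hC
  obtain ⟨x, rfl⟩ := hC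
  replace hHC : (H : Set (GL n k)) ⊆ (x : GL n k) • (K : Set (GL n k)) := hHC
  -- `1 ∈ x K` forces `x K = K ⊇ H`
  have h1 : (1 : GL n k) ∈ (x : GL n k) • (K : Set (GL n k)) := hHC H.one_mem
  have hxK : (x : GL n k) ∈ K := by
    obtain ⟨y, hy, hxy⟩ := h1
    have : (x : GL n k) = y⁻¹ := eq_inv_of_mul_eq_one_left hxy
    rw [this]; exact K.inv_mem hy
  rw [smul_coe_set hxK] at hHC
  exact le_antisymm hKH (fun g hg => hHC hg)

/-- **Springer 2.2.1** in the `k`-points vocabulary: a subgroup of `GL n k` is Zariski-connected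
(`IsZConnected`: algebraic, without proper algebraic subgroups of finite index) iff it is
algebraic and irreducible for the Zariski topology (`IsZConnected.isIrreducible`,
`isZConnected_of_isIrreducible`). Over any field. [cite: SpringerLAG1998, Prop 2.2.1] -/
theorem isZConnected_iff_isIrreducible {H : Subgroup (GL n k)} :
    IsZConnected H ↔ IsAlgebraicSubgroup H ∧ IsIrreducible (H : Set (GL n k)) :=
  ⟨fun h => ⟨h.1, h.isIrreducible⟩, fun h => isZConnected_of_isIrreducible h.1 h.2⟩

/-- The trivial subgroup is Zariski-connected. [folklore] -/
theorem isZConnected_bot : IsZConnected (⊥ : Subgroup (GL n k)) :=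
  isZConnected_of_isIrreducible isAlgebraicSubgroup_bot
    (by simpa using isIrreducible_singleton (x := (1 : GL n k)))

end Closure

end Literature.NumberTheory.Automorphic
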